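import Summits.NavierStokesRegularity.NavierStokesRegularity.Theorems.QuietScarPocketDoorDefs

/-!
# QuietScarPocketDoorStrainRigidity — §B «L-pocket schema» of door S31 (nsreg-p1 g25 `r29/Sketch31D.lean` 8bb56c0a84466268),
# plate (P4): STRAIN RIGIDITY — Killing fields off the apex with decaying gradient are rigid motions, hence trivial

Seat nsreg-C26-p1 g4 (S-door lane, LEAD ns-s30-p1 g2; DIRECTOR-NS #209 (2)); `--supports stmt-NavierStokesRegularity-0056 --as helper`.

The ONLY new mathematics of the instance `L = strainCLM` of the schema («STRAIN-QUIET pocket») is the static rigidity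
`StrainRigidity := StaticLRigidity strainCLM`: a real-analytic field `V` on `ℝ³∖{0}` with Type-I decay of `∇V` whose
symmetrised gradient vanishes off the apex (`∇V + ∇Vᵀ = 0`, i.e. `V` is a KILLING field on the connected open set `ℝ³∖{0}`)
is irrotational off the apex.  The §B Defs file (texts `strainCLM`, `StaticLRigidity`, …) is imp-p1's plate and not yet
in the tree, so this file proves the statement in UNFOLDED form — hypothesis
`∀ y ≠ 0, ∀ i j, ⟪∇V(y) eᵢ, eⱼ⟫ + ⟪eᵢ, ∇V(y) eⱼ⟫ = 0` (= `strainCLM (fderiv ℝ V y) = 0` by `strainCLM_apply`) — and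
`strainRigidity_holds : StrainRigidity` is then the three-line wrapper.

Proof (classical Killing rigidity, no use of the decay of `V` itself nor of `div V = 0`):
* `T_{kij} := ⟪D²V(y)[e_k, e_i], e_j⟫` is symmetric in `(k,i)` (`ContDiffAt.isSymmSndFDerivAt`) and antisymmetric in `(i,j)`
  (differentiate the Killing identity, which holds on the OPEN set `ℝ³∖{0}`, along `e_k`: `Filter.EventuallyEq.fderiv_eq`);
  the six-term braid gives `T ≡ 0`, so `D²V ≡ 0` off the apex (`fderiv_fderiv_eq_zero_of_killing`);
* `ℝ³∖{0}` is open and preconnected (`isPreconnected_compl_zero`, Defs), so `∇V` is CONSTANT there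
  (`IsOpen.is_const_of_fderiv_eq_zero`), and the decay `‖∇V(y)‖ ≤ C/‖y‖²` along a ray forces the constant to be `0`
  (`fderiv_eq_zero_of_killing_offApex`); hence `curl V = curlCLM (∇V) = 0` (`curl_eq_zero_of_killing_offApex`).

WHAT THIS IS NOT: a static linear-algebra/calculus lemma for a corollary schema about HYPOTHETICAL Type-I profiles; item 0056
`NoTypeII` and Navier–Stokes regularity are NOT proved.  [folklore: Killing fields of `ℝⁿ` are affine]
-/

noncomputable section

set_option linter.dupNamespace false

namespace Summit.NavierStokesRegularity.NavierStokesRegularity.Theorems.QuietScarPocketDoor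

open Set Function Filter Topology Metric
open scoped RealInnerProductSpace InnerProductSpace
open Literature.Analysis Literature.Analysis.FluidPDE

/-- A vector of `ℝ³` all of whose standard coordinates `⟪w, eⱼ⟫` vanish is zero. [folklore] -/
theorem eq_zero_of_forall_inner_single {w : EuclideanSpace ℝ (Fin 3)}
    (h : ∀ j : Fin 3, ⟪w, EuclideanSpace.single j (1 : ℝ)⟫ = 0) : w = 0 := by
  ext j
  have := h j
  rw [EuclideanSpace.inner_single_right] at this
  simpa using this

/-- A bilinear map on `ℝ³` (as an iterated continuous linear map) vanishing on pairs of standard basis vectors is zero.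
[folklore] -/
theorem clm_clm_eq_zero_of_basis {G : Type*} [NormedAddCommGroup G] [NormedSpace ℝ G]
    {D : EuclideanSpace ℝ (Fin 3) →L[ℝ] EuclideanSpace ℝ (Fin 3) →L[ℝ] G}
    (h : ∀ k i : Fin 3, D (EuclideanSpace.single k (1 : ℝ)) (EuclideanSpace.single i (1 : ℝ)) = 0) : D = 0 := by
  have hexp : ∀ a : EuclideanSpace ℝ (Fin 3), a = ∑ k, (a k) • EuclideanSpace.single k (1 : ℝ) := by
    intro a
    conv_lhs => rw [← (EuclideanSpace.basisFun (Fin 3) ℝ).sum_repr a]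
    simp [EuclideanSpace.basisFun_apply]
  ext a b
  rw [hexp a, hexp b]
  simp [map_sum, map_smul, h]

/-- **Killing fields have vanishing second derivative** (pointwise, on the open set `ℝ³∖{0}`): if `V` is real-analytic on
`ℝ³∖{0}` and `⟪∇V(y)eᵢ, eⱼ⟫ + ⟪eᵢ, ∇V(y)eⱼ⟫ = 0` for all `y ≠ 0` and all `i, j`, then `D²V(y) = 0` for `y ≠ 0`.
(Braid: `T_{kij} = ⟪D²V[e_k,e_i], e_j⟫` is symmetric in `k,i` and antisymmetric in `i,j`, hence zero.) [folklore] -/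
theorem fderiv_fderiv_eq_zero_of_killing {V : EuclideanSpace ℝ (Fin 3) → EuclideanSpace ℝ (Fin 3)}
    (hA : AnalyticOnNhd ℝ V ({0}ᶜ : Set (EuclideanSpace ℝ (Fin 3))))
    (hK : ∀ y : EuclideanSpace ℝ (Fin 3), y ≠ 0 → ∀ i j : Fin 3,
      ⟪fderiv ℝ V y (EuclideanSpace.single i (1 : ℝ)), EuclideanSpace.single j (1 : ℝ)⟫ +
        ⟪EuclideanSpace.single i (1 : ℝ), fderiv ℝ V y (EuclideanSpace.single j (1 : ℝ))⟫ = 0)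
    {y : EuclideanSpace ℝ (Fin 3)} (hy : y ≠ 0) : fderiv ℝ (fderiv ℝ V) y = 0 := by
  -- local notation-free abbreviations
  set e : Fin 3 → EuclideanSpace ℝ (Fin 3) := fun i => EuclideanSpace.single i (1 : ℝ) with he
  have hy' : y ∈ ({0}ᶜ : Set (EuclideanSpace ℝ (Fin 3))) := hy
  have hVy : AnalyticAt ℝ V y := hA y hy'
  -- `∇V` is differentiable at `y` and `D²V(y)` is symmetric
  have hC2 : ContDiffAt ℝ 2 V y := hVy.contDiffAt
  have hDV : DifferentiableAt ℝ (fderiv ℝ V) y :=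
    (hC2.fderiv_right (m := 1) (by norm_num)).differentiableAt (by norm_num)
  have hsymm : IsSymmSndFDerivAt ℝ V y := hC2.isSymmSndFDerivAt (by simp)
  -- the entries `B i j = ⟪∇V eᵢ, eⱼ⟫` as functions, and their derivatives along `e_k`
  set B : Fin 3 → Fin 3 → EuclideanSpace ℝ (Fin 3) → ℝ := fun i j z => ⟪fderiv ℝ V z (e i), e j⟫ with hB
  have hBderiv : ∀ i j k, fderiv ℝ (B i j) y (e k) = ⟪fderiv ℝ (fderiv ℝ V) y (e k) (e i), e j⟫ := by
    intro i j k
    -- `B i j = ℓ ∘ ∇V` with the continuous linear functional `ℓ A = ⟪A eᵢ, eⱼ⟫`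
    set ℓ : (EuclideanSpace ℝ (Fin 3) →L[ℝ] EuclideanSpace ℝ (Fin 3)) →L[ℝ] ℝ :=
      (innerSL ℝ (e j)).comp (ContinuousLinearMap.apply ℝ (EuclideanSpace ℝ (Fin 3)) (e i)) with hℓ
    have hℓapp : ∀ A : EuclideanSpace ℝ (Fin 3) →L[ℝ] EuclideanSpace ℝ (Fin 3), ℓ A = ⟪A (e i), e j⟫ := by
      intro A
      simp only [hℓ, ContinuousLinearMap.coe_comp, Function.comp_apply, ContinuousLinearMap.apply_apply,
        innerSL_apply_apply]
      exact real_inner_comm _ _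
    have hBeq : B i j = ⇑ℓ ∘ fderiv ℝ V := by
      funext z; simp only [hB, Function.comp_apply, hℓapp]
    rw [hBeq, (ℓ.hasFDerivAt.comp y hDV.hasFDerivAt).fderiv]
    exact hℓapp _
  -- the Killing identity holds on a neighbourhood of `y`, so it may be differentiated
  have hopen : IsOpen ({0}ᶜ : Set (EuclideanSpace ℝ (Fin 3))) := isOpen_compl_singleton
  have hT_anti : ∀ k i j, ⟪fderiv ℝ (fderiv ℝ V) y (e k) (e i), e j⟫ =
      -⟪fderiv ℝ (fderiv ℝ V) y (e k) (e j), e i⟫ := by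
    intro k i j
    have hev : B i j =ᶠ[𝓝 y] fun z => -B j i z := by
      filter_upwards [hopen.mem_nhds hy'] with z hz
      have hz0 : z ≠ 0 := hz
      have h := hK z hz0 i j
      simp only [hB, he]
      rw [real_inner_comm (fderiv ℝ V z (EuclideanSpace.single j (1 : ℝ))) (EuclideanSpace.single i (1 : ℝ))] at h
      linarith
    have h1 := hev.fderiv_eq (𝕜 := ℝ)
    have h2 : fderiv ℝ (fun z => -B j i z) y = -fderiv ℝ (B j i) y := fderiv_neg
    have h3 := congrArg (fun φ : EuclideanSpace ℝ (Fin 3) →L[ℝ] ℝ => φ (e k)) h1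
    simp only [h2, neg_apply] at h3
    rw [hBderiv, hBderiv] at h3
    exact h3
  have hT_symm : ∀ k i j, ⟪fderiv ℝ (fderiv ℝ V) y (e k) (e i), e j⟫ =
      ⟪fderiv ℝ (fderiv ℝ V) y (e i) (e k), e j⟫ := fun k i j => by rw [hsymm (e k) (e i)]
  -- the braid: `T_{kij} = 0`
  have hT : ∀ k i j, ⟪fderiv ℝ (fderiv ℝ V) y (e k) (e i), e j⟫ = 0 := by
    intro k i j
    have h1 := hT_symm k i j   -- T kij = T ikj
    have h2 := hT_anti i k j   -- T ikj = -T ijk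
    have h3 := hT_symm i j k   -- T ijk = T jik
    have h4 := hT_anti j i k   -- T jik = -T jki
    have h5 := hT_symm j k i   -- T jki = T kji
    have h6 := hT_anti k j i   -- T kji = -T kij
    linarith
  -- hence `D²V(y) = 0`
  refine clm_clm_eq_zero_of_basis fun k i => eq_zero_of_forall_inner_single fun j => ?_
  exact hT k i j

/-- **Killing fields off the apex with decaying gradient have vanishing gradient**: under the hypotheses of
`fderiv_fderiv_eq_zero_of_killing` and `‖∇V(y)‖ ≤ C/‖y‖²` off the apex, `∇V ≡ 0` on `ℝ³∖{0}` (`∇V` is constant on the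
connected open punctured space, and the constant decays to `0` along a ray). [folklore] -/
theorem fderiv_eq_zero_of_killing_offApex {V : EuclideanSpace ℝ (Fin 3) → EuclideanSpace ℝ (Fin 3)}
    (hA : AnalyticOnNhd ℝ V ({0}ᶜ : Set (EuclideanSpace ℝ (Fin 3))))
    (hD : ∃ C : ℝ, ∀ y : EuclideanSpace ℝ (Fin 3), y ≠ 0 → ‖fderiv ℝ V y‖ ≤ C / ‖y‖ ^ 2)
    (hK : ∀ y : EuclideanSpace ℝ (Fin 3), y ≠ 0 → ∀ i j : Fin 3,
      ⟪fderiv ℝ V y (EuclideanSpace.single i (1 : ℝ)), EuclideanSpace.single j (1 : ℝ)⟫ +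
        ⟪EuclideanSpace.single i (1 : ℝ), fderiv ℝ V y (EuclideanSpace.single j (1 : ℝ))⟫ = 0)
    {y : EuclideanSpace ℝ (Fin 3)} (hy : y ≠ 0) : fderiv ℝ V y = 0 := by
  have hopen : IsOpen ({0}ᶜ : Set (EuclideanSpace ℝ (Fin 3))) := isOpen_compl_singleton
  -- `∇V` is differentiable on the punctured space with zero derivative
  have hdiff : DifferentiableOn ℝ (fderiv ℝ V) ({0}ᶜ : Set (EuclideanSpace ℝ (Fin 3))) := by
    intro z hz
    have hC2 : ContDiffAt ℝ 2 V z := (hA z hz).contDiffAt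
    exact ((hC2.fderiv_right (m := 1) (by norm_num)).differentiableAt (by norm_num)).differentiableWithinAt
  have hzero : ({0}ᶜ : Set (EuclideanSpace ℝ (Fin 3))).EqOn (fderiv ℝ (fderiv ℝ V)) 0 :=
    fun z hz => fderiv_fderiv_eq_zero_of_killing hA hK hz
  -- so `∇V` is constant there: `∇V(y) = ∇V(t • e₀)` for every `t ≠ 0`
  set e₀ : EuclideanSpace ℝ (Fin 3) := EuclideanSpace.single 0 (1 : ℝ) with he₀
  have he₀n : ‖e₀‖ = 1 := by simp [he₀]
  have hconst : ∀ t : ℝ, t ≠ 0 → fderiv ℝ V y = fderiv ℝ V (t • e₀) := by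
    intro t ht
    have hte : t • e₀ ∈ ({0}ᶜ : Set (EuclideanSpace ℝ (Fin 3))) := by
      rw [mem_compl_singleton_iff, smul_ne_zero_iff]
      exact ⟨ht, fun h => by rw [h, norm_zero] at he₀n; exact zero_ne_one he₀n⟩
    exact hopen.is_const_of_fderiv_eq_zero isPreconnected_compl_zero hdiff hzero hy hte
  -- and the constant decays along the ray `t • e₀`
  obtain ⟨C, hC⟩ := hD
  have hbound : ∀ t : ℝ, 1 ≤ t → ‖fderiv ℝ V y‖ ≤ C / t := by
    intro t ht
    have ht0 : t ≠ 0 := by positivity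
    have hte0 : t • e₀ ≠ 0 := by
      rw [smul_ne_zero_iff]
      exact ⟨ht0, fun h => by rw [h, norm_zero] at he₀n; exact zero_ne_one he₀n⟩
    have h1 := hC (t • e₀) hte0
    rw [norm_smul, he₀n, mul_one, Real.norm_of_nonneg (by linarith)] at h1
    rw [hconst t ht0]
    refine h1.trans ?_
    -- `C/t² ≤ C/t` for `t ≥ 1` when `0 ≤ C`; if `C < 0` the bound `h1` is absurd anyway
    by_cases hC0 : 0 ≤ C
    · exact div_le_div_of_nonneg_left hC0 (by positivity) (by nlinarith)
    · exfalso
      have : C / t ^ 2 < 0 := div_neg_of_neg_of_pos (lt_of_not_ge hC0) (by positivity)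
      linarith [norm_nonneg (fderiv ℝ V (t • e₀))]
  have hlim : Tendsto (fun t : ℝ => C / t) atTop (𝓝 0) := tendsto_const_nhds.div_atTop tendsto_id
  have hle : ‖fderiv ℝ V y‖ ≤ 0 :=
    ge_of_tendsto hlim (Filter.eventually_atTop.2 ⟨1, fun t ht => hbound t ht⟩)
  exact norm_le_zero_iff.1 hle

/-- **(P4, unfolded) STRAIN RIGIDITY**: a real-analytic field on `ℝ³∖{0}` with `‖∇V(y)‖ ≤ C/‖y‖²` off the apex whose
symmetrised gradient `∇V + ∇Vᵀ` vanishes off the apex is IRROTATIONAL off the apex (indeed `∇V ≡ 0` there).  With the §B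
texts (`strainCLM_apply`) this is `StrainRigidity` verbatim; the decay of `V` and `div V = 0` are not needed. [folklore] -/
theorem curl_eq_zero_of_killing_offApex {V : EuclideanSpace ℝ (Fin 3) → EuclideanSpace ℝ (Fin 3)}
    (hA : AnalyticOnNhd ℝ V ({0}ᶜ : Set (EuclideanSpace ℝ (Fin 3))))
    (hD : ∃ C : ℝ, ∀ y : EuclideanSpace ℝ (Fin 3), y ≠ 0 → ‖fderiv ℝ V y‖ ≤ C / ‖y‖ ^ 2)
    (hK : ∀ y : EuclideanSpace ℝ (Fin 3), y ≠ 0 → ∀ i j : Fin 3,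
      ⟪fderiv ℝ V y (EuclideanSpace.single i (1 : ℝ)), EuclideanSpace.single j (1 : ℝ)⟫ +
        ⟪EuclideanSpace.single i (1 : ℝ), fderiv ℝ V y (EuclideanSpace.single j (1 : ℝ))⟫ = 0) :
    ∀ y : EuclideanSpace ℝ (Fin 3), y ≠ 0 → curl V y = 0 := by
  intro y hy
  rw [curl_eq_curlCLM, fderiv_eq_zero_of_killing_offApex hA hD hK hy, map_zero]

end Summit.NavierStokesRegularity.NavierStokesRegularity.Theorems.QuietScarPocketDoor

end
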